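/-
Copyright (c) 2026 the pub-hodgecm-mathlib formalisation cell (harness21).  Prover seat hodgecm-mathlib-K2E3-p11 (g5), Track B «K2-LIT» ∕ h413
(`stmt-HodgeConjecture-24833`), line `K2_E3_EllipticInputs`, road «GL-[M6]-sc» brick T15-log (MIXED HALF), FILE M1: `|Q|^{-s}` IS INTEGRABLE OVER BOXES for EVERY
`s < 1`, `Q` a diagonal non-degenerate quadratic form in `≥ 3` variables over a non-archimedean local field.  2026-09-04.
-/
import Summits.HodgeConjecture.HodgeConjecture.Theorems.K2E3DiagonalFormInvSqrtIntegrable   -- ★ K2E3-p12 (g3): the `s = 1∕2` case, shell lemmas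
import Mathlib.Analysis.SpecialFunctions.Pow.NNReal
import HarnessLib

/-!
# K2_E3 road (h413), «GL-[M6]-sc» brick T15-log (mixed half), FILE M1 — `∫_{box} |Q(x)|_F^{-s} dx < ∞` for every `s < 1`

Cell `pub/hodgecm-mathlib` (D-0151), Track B, seat K2E3-p11 (g5) (T15-log MIXED HALF, `K2/STATUS.md` 2026-09-04 07:18:47Z; road owner K2E3-p23 (g5),
MEMO «M6sc-BLUEPRINT v4» §2 T15-log).  `--supports stmt-HodgeConjecture-24833 --as helper`; THEOREMS ONLY (no definition ∕ instance ∕ notation ∕ named fact ∕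
`sorry`); never imports `Cruxes/…/Lines`.  COUNT-NEUTRAL.

WHY.  Harish-Chandra's Theorem 15 with `ε`-room: `|η|^{-1∕2-ε} ∈ L¹_loc`.  On `𝔤𝔩₂(F)` the discriminant `η(Y) = disc χ_Y` is a diagonal non-degenerate TERNARY
form in linear coordinates (★ `K2E3GL2DiscrInvSqrtLocallyIntegrable.discr_charpoly_eq_ternaryForm`), so the `𝔤𝔩₂` case — needed with `ε > 0` on the ELLIPTIC
set of `𝔤𝔩₂` by the mixed half of T15-log on `𝔤𝔩₃` — comes down to the form-level statement of this file, the `s < 1` version of ★ K2E3-p12 (g3)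
`lintegral_piPrimePowBall_sqrt_normAbs_inv_lt_top` (`s = 1∕2`) [Igusa: `∫ |Q|^{σ}` converges for `Re σ > −1` when `r ≥ 3`]:

* `exists_measure_inter_preimage_shell_le` — THE FIBRE-VOLUME BOUND: there are `M` and `m` with `Q(box) ⊆ 𝔭^m` and
  `μ^⊗ι(box ∩ Q⁻¹(𝔭^j ∖ 𝔭^{j+1})) ≤ M · μ(𝔭^j ∖ 𝔭^{j+1})` for every shell (Weil's continuous bounded density of `Q_*(1_{box} dx)`, ★ `exists_continuous_fibreDensity`,
  tested against the Schwartz–Bruhat indicator of ONE shell);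
* **`lintegral_piPrimePowBall_normAbs_rpow_neg_lt_top`** — `∫⁻_{(𝔭^{n₀})^ι} |Σᵢ cᵢ xᵢ²|_F^{-s} dμ^⊗ι < ∞` for `0 < s < 1` (shell decomposition + the geometric series
  `Σ_i (q^{-(m+i)})^{1-s}`; the integrand is the `ℝ≥0`-power, `= 0` on the null cone).
Hypotheses as in ★ p12: `2 ≠ 0` in `F` and a continuous non-trivial additive character `ψ` (both automatic at the consumers' `F = L_w`, `char 0`).
[HarishChandra1999AdmissibleDistributions, Thm. 4.4 p. 11, Thm. 6.1 ∕ Cor. 6.2 p. 45] [Weil1965, Chap. III n° 36 Prop. 6 p. 54] [Igusa1978, Ch. II §7 Thm. 1]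
[HarishChandra1970, Part VII §3 Thm. 15 p. 72]
HONEST LABEL: HC_CM is proved only modulo the 7 printed citations (2 remaining named inputs: hLiu418 = stmt-HodgeConjecture-24832, h413 =
stmt-HodgeConjecture-24833) until rung 0 closes; count-neutral helper.

## References
* [HarishChandra1999AdmissibleDistributions] Harish-Chandra (DeBacker–Sally), *Admissible Invariant Distributions on Reductive p-adic Groups* (1999), Thm. 4.4, Thm. 6.1, Cor. 6.2.
* [HarishChandra1970] Harish-Chandra (van Dijk), *Harmonic Analysis on Reductive p-adic Groups*, LNM 162 (1970), Part VII §3 Thm. 15.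
* [Weil1965] A. Weil, *Sur la formule de Siegel dans la théorie des groupes classiques*, Acta Math. 113 (1965), Chap. III n° 36, Prop. 6.
* [Igusa1978] J.-I. Igusa, *Lectures on Forms of Higher Degree*, Tata Institute (1978), Ch. II §7.
-/

set_option autoImplicit false
set_option linter.dupNamespace false

noncomputable section

open MeasureTheory Filter Topology Set
open scoped NNReal ENNReal
open Literature.NumberTheory.Automorphic Literature.NumberTheory.Automorphic.LocalFieldHaar Literature.NumberTheory.Weil1965
open Literature.NumberTheory.GaloisRepresentations Literature.NumberTheory.GaloisRepresentations.IsNonarchimedeanLocalField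
open Summit.HodgeConjecture.HodgeConjecture.Cruxes.H413.K2E3DiagonalFormInvSqrtIntegrable

namespace Summit.HodgeConjecture.HodgeConjecture.Cruxes.H413.K2E3DiagonalFormRpowNegIntegrable

variable {F : Type*} [Field F] [ValuativeRel F] [TopologicalSpace F] [IsNonarchimedeanLocalField F]

/-! ## §1  The weight `|b|^{-s}` on a shell -/

/-- On the shell `𝔭^j ∖ 𝔭^{j+1}` the weight `|b|_F^{-s}` is the constant `(q^{-j})^{-s}` (★ `mem_shell_iff`). [cite: WeilBNT1967, Ch. I §4] -/
theorem normAbs_rpow_neg_of_mem_shell {j : ℤ} {b : F} (hb : b ∈ primePowBall F j \ primePowBall F (j + 1)) (s : ℝ) :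
    (normAbs F b) ^ (-s) = (((residueFieldCard F : ℝ≥0)⁻¹ ^ j)) ^ (-s) := by
  rw [mem_shell_iff.1 hb]

/-! ## §2  Fibre volumes and `∫⁻_{box} |Q|^{-s} < ∞` -/

section Box

variable {ι : Type*} [Fintype ι] [MeasurableSpace F] [BorelSpace F] (μ : Measure F) [μ.IsAddHaarMeasure]

set_option maxHeartbeats 800000 in
/-- **THE FIBRE-VOLUME BOUND.**  For a diagonal non-degenerate form `Q = Σᵢ cᵢ xᵢ²` in `r = card ι ≥ 3` variables (`2 ≠ 0`, continuous non-trivial `ψ`) and a box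
`B = (𝔭^{n₀})^ι`: there are `M ≥ 0` and `m ∈ ℤ` with `Q(B) ⊆ 𝔭^m` and `μ^⊗ι(B ∩ Q⁻¹(𝔭^j ∖ 𝔭^{j+1})) ≤ M · μ(𝔭^j ∖ 𝔭^{j+1})` for every `j` — Weil's continuous
bounded density `D` of `Q_*(1_B dx)` (★ `exists_continuous_fibreDensity`) tested on the Schwartz–Bruhat indicator of the shell.
[cite: Weil1965, Chap. III n° 36 Prop. 6, p. 54] [cite: Igusa1978, Ch. II §7 Thm. 1] -/
theorem exists_measure_inter_preimage_shell_le {ψ : AddChar F Circle} (hψ : ψ.IsContinuousNontrivial) (h2 : (2 : F) ≠ 0)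
    {c : ι → F} (hc : ∀ i, c i ≠ 0) (hr : 3 ≤ Fintype.card ι) (n₀ : ℤ) :
    ∃ M : ℝ≥0, ∃ m : ℤ, (∀ x ∈ piPrimePowBall F ι n₀, ∑ i, c i * x i ^ 2 ∈ primePowBall F m) ∧
      ∀ j : ℤ, (Measure.pi fun _ : ι => μ) (piPrimePowBall F ι n₀ ∩ (fun x => ∑ i, c i * x i ^ 2) ⁻¹' (primePowBall F j \ primePowBall F (j + 1))) ≤
        M * μ (primePowBall F j \ primePowBall F (j + 1)) := by
  classical
  haveI : T2Space F := (isLocalField F).toT2Space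
  haveI : SecondCountableTopology F := secondCountableTopology_localField F
  haveI : LocallyCompactSpace F := (isLocalField F).toLocallyCompactSpace
  set ν : Measure (ι → F) := Measure.pi fun _ : ι => μ with hν
  set B : Set (ι → F) := piPrimePowBall F ι n₀ with hB
  set Q : (ι → F) → F := fun x => ∑ i, c i * x i ^ 2 with hQ
  have hBm : MeasurableSet B := measurableSet_piPrimePowBall n₀
  have hQc : Continuous Q := continuous_finsetSum _ fun i _ => continuous_const.mul ((continuous_apply i).pow 2)
  haveI hνH : ν.IsAddHaarMeasure := by rw [hν]; infer_instance
  obtain ⟨d, hd⟩ := hψ.exists_hasConductorExp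
  obtain ⟨v₂, hv₂⟩ := exists_normAbs_eq_inv_zpow h2
  have hΦ : (B.indicator fun _ => (1 : ℂ)) ∈ SchwartzBruhat (ι → F) := indicator_piPrimePowBall_mem_schwartzBruhat n₀ 1
  obtain ⟨D, -, ⟨M, hM⟩, hDg⟩ := exists_continuous_fibreDensity μ hd hv₂ hc hΦ hr
  have hM0 : 0 ≤ M := (norm_nonneg _).trans (hM 0)
  obtain ⟨m, hm⟩ := exists_sum_sq_mem_primePowBall_of_ne_zero c hΦ
  have hmB : ∀ x ∈ B, Q x ∈ primePowBall F m := fun x hx => hm x (by rw [Set.indicator_of_mem hx]; exact one_ne_zero)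
  refine ⟨M.toNNReal, m, hmB, fun j => ?_⟩
  set S : Set F := primePowBall F j \ primePowBall F (j + 1) with hS
  set A : Set (ι → F) := B ∩ Q ⁻¹' S with hA
  have hSm : MeasurableSet S := measurableSet_shell _
  have hAm : MeasurableSet A := hBm.inter (hQc.measurable hSm)
  have hνA : ν A < ∞ := (measure_mono Set.inter_subset_left).trans_lt (measure_piPrimePowBall_lt_top ν n₀)
  have hSfin : μ S < ∞ := (measure_mono Set.sdiff_subset).trans_lt (measure_primePowBall_lt_top μ j)
  -- Weil's identity tested on `g = 1_S`
  set g : F → ℂ := S.indicator fun _ => (1 : ℂ) with hg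
  have hgSB : g ∈ SchwartzBruhat F := indicator_shell_mem_schwartzBruhat (F := F) j 1
  have hleft : ∫ x, B.indicator (fun _ => (1 : ℂ)) x * g (Q x) ∂ν = ((ν.real A : ℝ) : ℂ) := by
    have hpt : ∀ x, B.indicator (fun _ => (1 : ℂ)) x * g (Q x) = A.indicator (fun _ => (1 : ℂ)) x := by
      intro x
      by_cases hx : x ∈ B
      · by_cases hQx : Q x ∈ S
        · rw [Set.indicator_of_mem hx, hg, Set.indicator_of_mem hQx, Set.indicator_of_mem (show x ∈ A from ⟨hx, hQx⟩), mul_one]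
        · rw [hg, Set.indicator_of_notMem hQx, Set.indicator_of_notMem (show x ∉ A from fun h => hQx h.2), mul_zero]
      · rw [Set.indicator_of_notMem hx, Set.indicator_of_notMem (show x ∉ A from fun h => hx h.1), zero_mul]
    simp_rw [hpt]
    rw [integral_indicator hAm, setIntegral_const, Complex.real_smul, mul_one, measureReal_def]
  have hright : ‖∫ b, D b * g b ∂μ‖ ≤ M * μ.real S := by
    have hmaj : Integrable (fun b => S.indicator (fun _ => (1 : ℝ)) b) μ :=
      (integrable_indicator_iff hSm).2 ((integrableOn_const_iff).2 (Or.inr hSfin))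
    calc ‖∫ b, D b * g b ∂μ‖ ≤ ∫ b, M * S.indicator (fun _ => (1 : ℝ)) b ∂μ := by
          refine norm_integral_le_of_norm_le (hmaj.const_mul M) (Eventually.of_forall fun b => ?_)
          rw [norm_mul]
          by_cases hb : b ∈ S
          · rw [hg, Set.indicator_of_mem hb, Set.indicator_of_mem hb, norm_one]
            exact mul_le_mul (hM b) le_rfl zero_le_one hM0
          · rw [hg, Set.indicator_of_notMem hb, Set.indicator_of_notMem hb, norm_zero, mul_zero, mul_zero]
      _ = M * μ.real S := by rw [integral_const_mul, integral_indicator hSm, setIntegral_const, smul_eq_mul, mul_one]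
  have hid := hDg g hgSB
  rw [hleft] at hid
  have hreal : ν.real A ≤ M * μ.real S := by
    calc ν.real A ≤ ‖((ν.real A : ℝ) : ℂ)‖ := by rw [Complex.norm_real]; exact le_abs_self _
      _ = ‖∫ b, D b * g b ∂μ‖ := by rw [hid]
      _ ≤ M * μ.real S := hright
  -- back to `ℝ≥0∞`
  have h1 : ν A = ENNReal.ofReal (ν.real A) := by rw [measureReal_def, ENNReal.ofReal_toReal hνA.ne]
  have h2' : ((M.toNNReal : ℝ≥0) : ℝ≥0∞) * μ S = ENNReal.ofReal (M * μ.real S) := by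
    rw [ENNReal.ofReal_mul hM0, measureReal_def, ENNReal.ofReal_toReal hSfin.ne]
    rfl
  rw [h1, h2']
  exact ENNReal.ofReal_le_ofReal hreal

set_option maxHeartbeats 800000 in
/-- **`∫⁻_{(𝔭^{n₀})^ι} |Σᵢ cᵢ xᵢ²|_F^{-s} dμ^⊗ι < ∞` for every `0 < s < 1`** (diagonal non-degenerate form in `r = card ι ≥ 3` variables; `2 ≠ 0`, continuous
non-trivial `ψ`; `μ` any additive Haar measure; the integrand is the `ℝ≥0`-power, `0` on the null cone `Q = 0`).  Shell by shell: `|Q|^{-s} = (q^{-(m+i)})^{-s}` on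
`B ∩ Q⁻¹(shell_{m+i})`, whose volume is `≤ M μ(shell_{m+i}) = M q^{-(m+i)}(1 − q⁻¹)μ(𝒪)` (§2), and `Σ_i (q^{-(m+i)})^{1-s}` is a convergent geometric series.
Harish-Chandra's Theorem 15 «`|η|^{-1∕2-ε} ∈ L¹_loc`» at the form level. [cite: HarishChandra1970, Part VII §3 Thm. 15 p. 72] [cite: Weil1965, Chap. III n° 36 Prop. 6, p. 54]
[cite: Igusa1978, Ch. II §7 Thm. 1] -/
theorem lintegral_piPrimePowBall_normAbs_rpow_neg_lt_top {ψ : AddChar F Circle} (hψ : ψ.IsContinuousNontrivial) (h2 : (2 : F) ≠ 0)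
    {c : ι → F} (hc : ∀ i, c i ≠ 0) (hr : 3 ≤ Fintype.card ι) (n₀ : ℤ) {s : ℝ} (hs0 : 0 < s) (hs1 : s < 1) :
    ∫⁻ x in piPrimePowBall F ι n₀, ((((normAbs F (∑ i, c i * x i ^ 2)) ^ (-s) : ℝ≥0)) : ℝ≥0∞) ∂(Measure.pi fun _ : ι => μ) < ∞ := by
  classical
  haveI : T2Space F := (isLocalField F).toT2Space
  haveI : SecondCountableTopology F := secondCountableTopology_localField F
  haveI : LocallyCompactSpace F := (isLocalField F).toLocallyCompactSpace
  set ν : Measure (ι → F) := Measure.pi fun _ : ι => μ with hν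
  set B : Set (ι → F) := piPrimePowBall F ι n₀ with hB
  set Q : (ι → F) → F := fun x => ∑ i, c i * x i ^ 2 with hQ
  set q0 : ℝ≥0 := (residueFieldCard F : ℝ≥0)⁻¹ with hq0
  have hq0pos : 0 < q0 := inv_residueFieldCard_pos
  have hq0lt : q0 < 1 := inv_residueFieldCard_lt_one
  have hBm : MeasurableSet B := measurableSet_piPrimePowBall n₀
  have hQc : Continuous Q := continuous_finsetSum _ fun i _ => continuous_const.mul ((continuous_apply i).pow 2)
  obtain ⟨M, m, hmB, hshell⟩ := exists_measure_inter_preimage_shell_le μ hψ h2 hc hr n₀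
  -- shells, pieces, weights
  set S : ℕ → Set F := fun i => primePowBall F (m + i) \ primePowBall F (m + i + 1) with hS
  set A : ℕ → Set (ι → F) := fun i => B ∩ Q ⁻¹' (S i) with hA
  set w : ℕ → ℝ≥0 := fun i => (q0 ^ (m + (i : ℤ))) ^ (-s) with hw
  have hSm : ∀ i, MeasurableSet (S i) := fun i => measurableSet_shell _
  have hAm : ∀ i, MeasurableSet (A i) := fun i => hBm.inter (hQc.measurable (hSm i))
  have hAB : ∀ i, A i ⊆ B := fun i => Set.inter_subset_left
  have hνA : ∀ i, ν (A i) < ∞ := fun i => (measure_mono (hAB i)).trans_lt (measure_piPrimePowBall_lt_top ν n₀)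
  have hSfin : ∀ i, μ (S i) < ∞ := fun i => (measure_mono Set.sdiff_subset).trans_lt (measure_primePowBall_lt_top μ (m + i))
  -- the geometric series `Σ_i w_i μ(S_i) = K Σ_i r^i`
  have hq0R : (0 : ℝ) < q0 := by exact_mod_cast hq0pos
  have hq0R1 : (q0 : ℝ) < 1 := by exact_mod_cast hq0lt
  set r : ℝ := (q0 : ℝ) ^ (1 - s) with hr'
  have hr0 : 0 ≤ r := Real.rpow_nonneg hq0R.le _
  have hr1 : r < 1 := Real.rpow_lt_one hq0R.le hq0R1 (by linarith)
  set K : ℝ := (q0 : ℝ) ^ ((m : ℝ) * (1 - s)) * (1 - (q0 : ℝ)) * μ.real (primePowBall F 0) with hK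
  have hK0 : 0 ≤ K := mul_nonneg (mul_nonneg (Real.rpow_nonneg hq0R.le _) (sub_nonneg.2 hq0R1.le)) measureReal_nonneg
  have hwS : ∀ i : ℕ, (w i : ℝ) * μ.real (S i) = K * r ^ i := by
    intro i
    have hwR : (w i : ℝ) = ((q0 : ℝ) ^ (m + (i : ℤ))) ^ (-s) := by
      simp only [hw, NNReal.coe_rpow, NNReal.coe_zpow]
    have hqR : ((residueFieldCard F : ℝ)⁻¹) = (q0 : ℝ) := by rw [hq0, NNReal.coe_inv, NNReal.coe_natCast]
    have hshellR : μ.real (S i) = (q0 : ℝ) ^ (m + (i : ℤ)) * (1 - (q0 : ℝ)) * μ.real (primePowBall F 0) := by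
      rw [hS]
      simp only
      rw [measureReal_shell μ (m + i), hqR]
    have hz : (q0 : ℝ) ^ (m + (i : ℤ)) = (q0 : ℝ) ^ ((m : ℝ) + (i : ℝ)) := by
      rw [← Real.rpow_intCast, Int.cast_add, Int.cast_natCast]
    have hpow : ((q0 : ℝ) ^ (m + (i : ℤ))) ^ (-s) * (q0 : ℝ) ^ (m + (i : ℤ)) = (q0 : ℝ) ^ ((m : ℝ) * (1 - s)) * r ^ i := by
      rw [hz, ← Real.rpow_mul hq0R.le, ← Real.rpow_add hq0R, hr', ← Real.rpow_natCast ((q0 : ℝ) ^ (1 - s)) i, ← Real.rpow_mul hq0R.le,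
        ← Real.rpow_add hq0R]
      congr 1
      ring
    rw [hwR, hshellR, show ((q0 : ℝ) ^ (m + (i : ℤ))) ^ (-s) * ((q0 : ℝ) ^ (m + (i : ℤ)) * (1 - (q0 : ℝ)) * μ.real (primePowBall F 0)) =
      (((q0 : ℝ) ^ (m + (i : ℤ))) ^ (-s) * (q0 : ℝ) ^ (m + (i : ℤ))) * (1 - (q0 : ℝ)) * μ.real (primePowBall F 0) by ring, hpow, hK]
    ring
  have hsumm : Summable fun i : ℕ => (w i : ℝ) * μ.real (S i) := by
    rw [show (fun i : ℕ => (w i : ℝ) * μ.real (S i)) = fun i => K * r ^ i from funext hwS]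
    exact (summable_geometric_of_lt_one hr0 hr1).mul_left K
  -- the integral is the series `Σ_i w_i ν(A_i)`
  have hpoint : ∀ x ∈ B, ((((normAbs F (Q x)) ^ (-s) : ℝ≥0)) : ℝ≥0∞) = ∑' i : ℕ, (A i).indicator (fun _ => (w i : ℝ≥0∞)) x := by
    intro x hx
    by_cases hQ0 : Q x = 0
    · rw [hQ0, map_zero, NNReal.zero_rpow (neg_ne_zero.2 hs0.ne'), ENNReal.coe_zero]
      symm
      refine ENNReal.tsum_eq_zero.2 fun i => Set.indicator_of_notMem (fun h => ?_) _
      have hQS : Q x ∈ S i := h.2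
      exact ne_zero_of_mem_shell hQS hQ0
    · obtain ⟨i₀, hi₀⟩ := exists_mem_shell_of_mem_primePowBall (hmB x hx) hQ0
      have hxA : x ∈ A i₀ := ⟨hx, hi₀⟩
      rw [tsum_eq_single i₀ fun i hi => Set.indicator_of_notMem (fun h => ?_) _]
      · rw [Set.indicator_of_mem hxA, normAbs_rpow_neg_of_mem_shell hi₀]
      · have hQS : Q x ∈ S i := h.2
        have hne : m + (i : ℤ) ≠ m + (i₀ : ℤ) := fun e => hi (by omega)
        exact Set.disjoint_left.1 (disjoint_shell hne) hQS hi₀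
  have hseries : ∫⁻ x in B, ((((normAbs F (Q x)) ^ (-s) : ℝ≥0)) : ℝ≥0∞) ∂ν = ∑' i : ℕ, (w i : ℝ≥0∞) * ν (A i) := by
    rw [setLIntegral_congr_fun hBm hpoint, lintegral_tsum fun i => ((measurable_const.indicator (hAm i)).aemeasurable)]
    refine tsum_congr fun i => ?_
    rw [lintegral_indicator_const (hAm i), Measure.restrict_apply (hAm i), Set.inter_eq_left.2 (hAB i)]
  -- conclusion: `Σ_i w_i ν(A_i) ≤ M Σ_i w_i μ(S_i) = M · ofReal(Σ K r^i) < ∞`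
  rw [hseries]
  have hterm : ∀ i, (w i : ℝ≥0∞) * ν (A i) ≤ (M : ℝ≥0∞) * ENNReal.ofReal ((w i : ℝ) * μ.real (S i)) := by
    intro i
    calc (w i : ℝ≥0∞) * ν (A i) ≤ (w i : ℝ≥0∞) * ((M : ℝ≥0∞) * μ (S i)) := mul_le_mul' le_rfl (hshell (m + i))
      _ = (M : ℝ≥0∞) * ((w i : ℝ≥0∞) * μ (S i)) := by ring
      _ = (M : ℝ≥0∞) * ENNReal.ofReal ((w i : ℝ) * μ.real (S i)) := by
          rw [ENNReal.ofReal_mul (NNReal.coe_nonneg _), ENNReal.ofReal_coe_nnreal, measureReal_def, ENNReal.ofReal_toReal (hSfin i).ne]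
  calc ∑' i : ℕ, (w i : ℝ≥0∞) * ν (A i) ≤ ∑' i : ℕ, (M : ℝ≥0∞) * ENNReal.ofReal ((w i : ℝ) * μ.real (S i)) := ENNReal.tsum_le_tsum hterm
    _ = (M : ℝ≥0∞) * ENNReal.ofReal (∑' i : ℕ, (w i : ℝ) * μ.real (S i)) := by
        rw [ENNReal.tsum_mul_left, ENNReal.ofReal_tsum_of_nonneg (fun i => mul_nonneg (NNReal.coe_nonneg _) measureReal_nonneg) hsumm]
    _ < ∞ := ENNReal.mul_lt_top ENNReal.coe_lt_top ENNReal.ofReal_lt_top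

end Box

end Summit.HodgeConjecture.HodgeConjecture.Cruxes.H413.K2E3DiagonalFormRpowNegIntegrable

end
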